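import Summits.QuantumFields.GaugeBoot.TwistMergeLocality
import HarnessLib

/-!
# Power series in `β` of the `1/N` coefficients, I: the coefficient family (gauge-boot, ADDENDUM 31 part A)

HONEST FRAMING (cell `pub-gaugeboot`, page 1 of every file): the venture produces certified bounds
on lattice expectations at stated coupling, gauge group, dimension and torus size; NOT a mass gap,
NOT a continuum limit, NOT a string tension; NOT Yang–Mills-summit-bearing (barriers
`FixedCouplingUltralocality`, `PerturbativeInvisibility`).  Strong-coupling `SO(N)` lattice gauge theory with free boundary
condition (S. Chatterjee, Comm. Math. Phys. **366** (2019); S. Chatterjee, J. Jafarov, arXiv:1604.04777); nothing about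
four-dimensional continuum Yang–Mills or a mass gap.

## Content

Chatterjee–Jafarov (§7, Theorem 7.1) expand every coefficient `f_k(β, s)` of the `1/N` expansion as a power series
`Σ_i a_{i,k}(s) βⁱ` whose coefficients are defined by a double recursion (deformations raise the `β`-degree `i`, twistings raise
the `1/N`-degree by one, mergers by two, splittings keep both degrees and lower the index `ι(s)`).  This file constructs the
SYMMETRIZED version of that coefficient family — the one matching the lane's symmetrized recursion (5.2) carried by
`oneOverN_master`: a family `b : ℕ → ℕ → 𝒮 → ℝ` (level `j = k + 2`, `β`-degree `i`; levels `0, 1` are zero) with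
`b_{2,0}(∅) = 1`, all other values at `∅` zero, and for every non-null `s` all of whose components are non-null

`|s| b_{k+2,i}(s) − (Σ_{𝕊⁻} b_{k+2,i} − Σ_{𝕊⁺} b_{k+2,i} + Σ_{𝔻⁻} b_{k+2,i−1} − Σ_{𝔻⁺} b_{k+2,i−1})`
`  = |s| b_{k+1,i}(s) + (Σ_{𝕋⁻} b_{k+1,i} − Σ_{𝕋⁺} b_{k+1,i}) + (Σ_{𝕄⁻} b_{k,i} − Σ_{𝕄⁺} b_{k,i})`

(`b_{·,−1} = 0`).  The construction is by well-founded recursion on the index `ι(s)` (splittings lower it,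
`LoopSeq.index_posSplitAt_lt` / `index_negSplitAt_lt`, the source's Lemma 9.8) inside a recursion on `i` inside a recursion on
the level; no `def` is introduced — the family is produced by an existence theorem with its characterising equations
(`seriesCoeff_exists`), and it is unique (`seriesCoeff_unique`).

Everything is `[folklore]` given the tree's index bookkeeping.
-/

noncomputable section

open Finset
open Literature.MathematicalPhysics.QuantumFieldTheory.Chatterjee2019LargeN

namespace Summit.QuantumFields.GaugeBoot

namespace StringDuality

variable {d : ℕ}

/-! ## One layer: fixed level and fixed `β`-degree -/

/-- **One layer of the coefficient recursion.**  Given the deformation input `D` (the previous `β`-degree), the source `S`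
(lower levels) and the value `v` at `∅`, there is `f : 𝒮 → ℝ` with `f(∅) = v`, `f = 0` on non-null sequences having a null
component, and `|s| f(s) − (Σ_{𝕊⁻} f − Σ_{𝕊⁺} f + Σ_{𝔻⁻} D − Σ_{𝔻⁺} D) = S(s)` for every non-null `s` with non-null
components — well-founded recursion on `ι(s)`. [cite: ChatterjeeJafarov2016OneOverN, §7 (definition of a_{i,k}(s), «by Lemma (iota2) the fourth term is well-defined»); Chatterjee2019LargeN, Lemma 9.8] -/
theorem seriesLayer_exists (D S : LoopSeq d → ℝ) (v : ℝ) :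
    ∃ f : LoopSeq d → ℝ, f [] = v ∧
      (∀ s : LoopSeq d, s ≠ [] → ¬ (∀ l ∈ s, l ≠ []) → f s = 0) ∧
      ∀ s : LoopSeq d, s ≠ [] → (∀ l ∈ s, l ≠ []) →
        (s.len : ℝ) * f s -
            ((∑ o : InvIdx s, f (s.negSplitAt o)) - (∑ o : SameIdx s, f (s.posSplitAt o))
              + (∑ o : DeformIdx s, D (s.negDeformAt o)) - (∑ o : DeformIdx s, D (s.posDeformAt o))) = S s := by
  have hwf : WellFounded (InvImage (· < ·) (LoopSeq.index (d := d))) := InvImage.wf _ wellFounded_lt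
  -- the recursion functional (kept opaque: only its three defining properties are used)
  obtain ⟨F, hF, hFnil, hFbad⟩ :
      ∃ F : (s : LoopSeq d) → ((t : LoopSeq d) → InvImage (· < ·) (LoopSeq.index (d := d)) t s → ℝ) → ℝ,
        (∀ (s : LoopSeq d) (rec : (t : LoopSeq d) → InvImage (· < ·) (LoopSeq.index (d := d)) t s → ℝ)
          (h : s ≠ [] ∧ ∀ l ∈ s, l ≠ []), F s rec =
            (1 / (s.len : ℝ)) *
              (((∑ o : InvIdx s, rec (s.negSplitAt o) (LoopSeq.index_negSplitAt_lt h.2 o))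
                  - (∑ o : SameIdx s, rec (s.posSplitAt o) (LoopSeq.index_posSplitAt_lt h.2 o))
                  + (∑ o : DeformIdx s, D (s.negDeformAt o)) - (∑ o : DeformIdx s, D (s.posDeformAt o))) + S s)) ∧
        (∀ rec, F [] rec = v) ∧
        (∀ (s : LoopSeq d) (rec : (t : LoopSeq d) → InvImage (· < ·) (LoopSeq.index (d := d)) t s → ℝ),
          s ≠ [] → ¬ (∀ l ∈ s, l ≠ []) → F s rec = 0) := by
    refine ⟨fun s rec =>
      if h : s ≠ [] ∧ ∀ l ∈ s, l ≠ [] then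
        (1 / (s.len : ℝ)) *
          (((∑ o : InvIdx s, rec (s.negSplitAt o) (LoopSeq.index_negSplitAt_lt h.2 o))
              - (∑ o : SameIdx s, rec (s.posSplitAt o) (LoopSeq.index_posSplitAt_lt h.2 o))
              + (∑ o : DeformIdx s, D (s.negDeformAt o)) - (∑ o : DeformIdx s, D (s.posDeformAt o))) + S s)
      else if s = [] then v else 0, fun s rec h => ?_, fun rec => ?_, fun s rec hne hbad => ?_⟩
    · simp only [dif_pos h]
    · simp only [ne_eq, not_true_eq_false, false_and, dif_neg, not_false_eq_true, if_true]
    · have h : ¬ (s ≠ [] ∧ ∀ l ∈ s, l ≠ []) := fun h => hbad h.2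
      simp only [h, dif_neg, not_false_eq_true, hne, if_false]
  refine ⟨hwf.fix F, (WellFounded.fix_eq hwf F []).trans (hFnil _), fun s hne hbad =>
    (WellFounded.fix_eq hwf F s).trans (hFbad s _ hne hbad), fun s hne hgood => ?_⟩
  have hlen : (s.len : ℝ) ≠ 0 := by
    obtain ⟨l, hl⟩ := List.exists_mem_of_ne_nil s hne
    have h1 : 1 ≤ l.length := List.length_pos_of_ne_nil (hgood l hl)
    have h2 : l.length ≤ s.len := by
      unfold LoopSeq.len
      exact List.le_sum_of_mem (List.mem_map.mpr ⟨l, hl, rfl⟩)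
    have h3 : 0 < s.len := lt_of_lt_of_le (by omega : 0 < l.length) h2
    exact_mod_cast h3.ne'
  have hfix : hwf.fix F s = (1 / (s.len : ℝ)) *
        (((∑ o : InvIdx s, hwf.fix F (s.negSplitAt o))
            - (∑ o : SameIdx s, hwf.fix F (s.posSplitAt o))
            + (∑ o : DeformIdx s, D (s.negDeformAt o)) - (∑ o : DeformIdx s, D (s.posDeformAt o))) + S s) :=
    (WellFounded.fix_eq hwf F s).trans (hF s _ ⟨hne, hgood⟩)
  rw [hfix]
  field_simp
  ring

/-! ## One level: all `β`-degrees -/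

/-- **One level of the coefficient recursion.**  Given the two lower levels `P = b_{k+1}`, `Q = b_k` (as functions of the
`β`-degree) and the values `v i` at `∅`, there is `c : ℕ → 𝒮 → ℝ` (the level `b_{k+2}`) with `c i ∅ = v i`, `c i = 0` on
non-null sequences with a null component, and the symmetrized coefficient recursion: for non-null `s` with non-null
components, `|s| c_0(s) − (Σ_{𝕊⁻} c_0 − Σ_{𝕊⁺} c_0) = |s| P_0(s) + (Σ_{𝕋⁻} P_0 − Σ_{𝕋⁺} P_0) + (Σ_{𝕄⁻} Q_0 − Σ_{𝕄⁺} Q_0)` and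
`|s| c_{i+1}(s) − (Σ_{𝕊⁻} c_{i+1} − Σ_{𝕊⁺} c_{i+1} + Σ_{𝔻⁻} c_i − Σ_{𝔻⁺} c_i) = |s| P_{i+1}(s) + (Σ_{𝕋∓} ±P_{i+1}) + (Σ_{𝕄∓} ±Q_{i+1})`.
[cite: ChatterjeeJafarov2016OneOverN, §7 (the recursion (recurcoeff) for a_{i,k}); Chatterjee2019LargeN, Corollary 10.4] -/
theorem seriesLevel_exists (P Q : ℕ → LoopSeq d → ℝ) (v : ℕ → ℝ) :
    ∃ c : ℕ → LoopSeq d → ℝ, (∀ i, c i [] = v i) ∧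
      (∀ (i : ℕ) (s : LoopSeq d), s ≠ [] → ¬ (∀ l ∈ s, l ≠ []) → c i s = 0) ∧
      (∀ s : LoopSeq d, s ≠ [] → (∀ l ∈ s, l ≠ []) →
        (s.len : ℝ) * c 0 s - ((∑ o : InvIdx s, c 0 (s.negSplitAt o)) - (∑ o : SameIdx s, c 0 (s.posSplitAt o))) =
          (s.len : ℝ) * P 0 s
            + ((∑ o : SameIdx s, P 0 (s.negTwistAt o)) - ∑ o : InvIdx s, P 0 (s.posTwistAt o))
            + ((∑ o : MergeIdx s, Q 0 (s.negMergeAt o)) - ∑ o : MergeIdx s, Q 0 (s.posMergeAt o))) ∧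
      (∀ (i : ℕ) (s : LoopSeq d), s ≠ [] → (∀ l ∈ s, l ≠ []) →
        (s.len : ℝ) * c (i + 1) s -
            ((∑ o : InvIdx s, c (i + 1) (s.negSplitAt o)) - (∑ o : SameIdx s, c (i + 1) (s.posSplitAt o))
              + (∑ o : DeformIdx s, c i (s.negDeformAt o)) - (∑ o : DeformIdx s, c i (s.posDeformAt o))) =
          (s.len : ℝ) * P (i + 1) s
            + ((∑ o : SameIdx s, P (i + 1) (s.negTwistAt o)) - ∑ o : InvIdx s, P (i + 1) (s.posTwistAt o))
            + ((∑ o : MergeIdx s, Q (i + 1) (s.negMergeAt o)) - ∑ o : MergeIdx s, Q (i + 1) (s.posMergeAt o))) := by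
  -- the source at `β`-degree `i`
  let S : ℕ → LoopSeq d → ℝ := fun i s =>
    (s.len : ℝ) * P i s
      + ((∑ o : SameIdx s, P i (s.negTwistAt o)) - ∑ o : InvIdx s, P i (s.posTwistAt o))
      + ((∑ o : MergeIdx s, Q i (s.negMergeAt o)) - ∑ o : MergeIdx s, Q i (s.posMergeAt o))
  -- layer after layer
  let c : ℕ → LoopSeq d → ℝ := fun i =>
    Nat.rec (motive := fun _ => LoopSeq d → ℝ) (Classical.choose (seriesLayer_exists (fun _ => (0 : ℝ)) (S 0) (v 0)))
      (fun i ci => Classical.choose (seriesLayer_exists ci (S (i + 1)) (v (i + 1)))) i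
  have hc0 : c 0 = Classical.choose (seriesLayer_exists (fun _ => (0 : ℝ)) (S 0) (v 0)) := rfl
  have hcs : ∀ i, c (i + 1) = Classical.choose (seriesLayer_exists (c i) (S (i + 1)) (v (i + 1))) := fun _ => rfl
  refine ⟨c, fun i => ?_, fun i s hne hbad => ?_, fun s hne hgood => ?_, fun i s hne hgood => ?_⟩
  · rcases i with _ | i
    · rw [hc0]; exact (Classical.choose_spec (seriesLayer_exists (fun _ => (0 : ℝ)) (S 0) (v 0))).1
    · rw [hcs]; exact (Classical.choose_spec (seriesLayer_exists (c i) (S (i + 1)) (v (i + 1)))).1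
  · rcases i with _ | i
    · rw [hc0]; exact (Classical.choose_spec (seriesLayer_exists (fun _ => (0 : ℝ)) (S 0) (v 0))).2.1 s hne hbad
    · rw [hcs]; exact (Classical.choose_spec (seriesLayer_exists (c i) (S (i + 1)) (v (i + 1)))).2.1 s hne hbad
  · have h := (Classical.choose_spec (seriesLayer_exists (fun _ => (0 : ℝ)) (S 0) (v 0))).2.2 s hne hgood
    rw [← hc0] at h
    simp only [Finset.sum_const_zero, add_zero, sub_zero] at h
    exact h
  · have h := (Classical.choose_spec (seriesLayer_exists (c i) (S (i + 1)) (v (i + 1)))).2.2 s hne hgood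
    rw [← hcs] at h
    exact h

/-! ## All levels -/

/-- **The symmetrized Chatterjee–Jafarov coefficient family** `b : ℕ → ℕ → 𝒮 → ℝ` (level `j`, `β`-degree `i`; the `k`-th
coefficient of the `1/N` expansion lives at level `k + 2`): levels `0` and `1` vanish; `b_{2,0}(∅) = 1` and every other value
at `∅` is `0`; `b = 0` on non-null sequences with a null component; and for every non-null `s` with non-null components the
coefficient recursion holds (`β`-degree `0` without deformation terms, `β`-degree `i + 1` with the deformation terms of degree `i`).
[cite: ChatterjeeJafarov2016OneOverN, §7 (definition of a_{i,k}(s)), Theorem 7.1; Chatterjee2019LargeN, Corollary 10.4, Lemma 9.8] -/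
theorem seriesCoeff_exists :
    ∃ b : ℕ → ℕ → LoopSeq d → ℝ,
      (∀ (i : ℕ) (u : LoopSeq d), b 0 i u = 0) ∧ (∀ (i : ℕ) (u : LoopSeq d), b 1 i u = 0) ∧
      (∀ k i, b (k + 2) i [] = if k = 0 ∧ i = 0 then 1 else 0) ∧
      (∀ (j i : ℕ) (s : LoopSeq d), s ≠ [] → ¬ (∀ l ∈ s, l ≠ []) → b j i s = 0) ∧
      (∀ (k : ℕ) (s : LoopSeq d), s ≠ [] → (∀ l ∈ s, l ≠ []) →
        (s.len : ℝ) * b (k + 2) 0 s -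
            ((∑ o : InvIdx s, b (k + 2) 0 (s.negSplitAt o)) - (∑ o : SameIdx s, b (k + 2) 0 (s.posSplitAt o))) =
          (s.len : ℝ) * b (k + 1) 0 s
            + ((∑ o : SameIdx s, b (k + 1) 0 (s.negTwistAt o)) - ∑ o : InvIdx s, b (k + 1) 0 (s.posTwistAt o))
            + ((∑ o : MergeIdx s, b k 0 (s.negMergeAt o)) - ∑ o : MergeIdx s, b k 0 (s.posMergeAt o))) ∧
      (∀ (k i : ℕ) (s : LoopSeq d), s ≠ [] → (∀ l ∈ s, l ≠ []) →
        (s.len : ℝ) * b (k + 2) (i + 1) s -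
            ((∑ o : InvIdx s, b (k + 2) (i + 1) (s.negSplitAt o)) - (∑ o : SameIdx s, b (k + 2) (i + 1) (s.posSplitAt o))
              + (∑ o : DeformIdx s, b (k + 2) i (s.negDeformAt o)) - (∑ o : DeformIdx s, b (k + 2) i (s.posDeformAt o))) =
          (s.len : ℝ) * b (k + 1) (i + 1) s
            + ((∑ o : SameIdx s, b (k + 1) (i + 1) (s.negTwistAt o)) - ∑ o : InvIdx s, b (k + 1) (i + 1) (s.posTwistAt o))
            + ((∑ o : MergeIdx s, b k (i + 1) (s.negMergeAt o)) - ∑ o : MergeIdx s, b k (i + 1) (s.posMergeAt o))) := by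
  -- values at `∅` of level `j`
  let v : ℕ → ℕ → ℝ := fun j i => if j = 2 ∧ i = 0 then 1 else 0
  -- pairs (level `n`, level `n + 1`)
  let pr : ℕ → (ℕ → LoopSeq d → ℝ) × (ℕ → LoopSeq d → ℝ) := fun n =>
    Nat.rec (motive := fun _ => (ℕ → LoopSeq d → ℝ) × (ℕ → LoopSeq d → ℝ))
      ((fun _ _ => 0, fun _ _ => 0))
      (fun n p => (p.2, Classical.choose (seriesLevel_exists p.2 p.1 (v (n + 2))))) n
  let b : ℕ → ℕ → LoopSeq d → ℝ := fun n => (pr n).1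
  have hpr : ∀ n, pr (n + 1) = ((pr n).2, Classical.choose (seriesLevel_exists (pr n).2 (pr n).1 (v (n + 2)))) :=
    fun _ => rfl
  have hb0 : b 0 = fun _ _ => 0 := rfl
  have hb1 : b 1 = fun _ _ => 0 := rfl
  have hsnd : ∀ n, (pr n).2 = b (n + 1) := fun n => by
    show (pr n).2 = (pr (n + 1)).1
    rw [hpr]
  have hb2 : ∀ n, b (n + 2) = Classical.choose (seriesLevel_exists (b (n + 1)) (b n) (v (n + 2))) := by
    intro n
    have e1 : b (n + 2) = (pr (n + 1)).2 := congrArg Prod.fst (hpr (n + 1))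
    have e2 : (pr (n + 1)).2 = Classical.choose (seriesLevel_exists (pr n).2 (pr n).1 (v (n + 2))) :=
      congrArg Prod.snd (hpr n)
    rw [e1, e2, hsnd n]
  refine ⟨b, fun i u => by rw [hb0], fun i u => by rw [hb1], fun k i => ?_, fun j i s hne hbad => ?_,
    fun k s hne hgood => ?_, fun k i s hne hgood => ?_⟩
  · rw [hb2]
    have h := (Classical.choose_spec (seriesLevel_exists (b (k + 1)) (b k) (v (k + 2)))).1 i
    rw [h]
    simp [v]
  · rcases j with _ | _ | k
    · rw [hb0]
    · show b 1 i s = 0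
      rw [hb1]
    · show b (k + 2) i s = 0
      rw [hb2]
      exact (Classical.choose_spec (seriesLevel_exists (b (k + 1)) (b k) (v (k + 2)))).2.1 i s hne hbad
  · have h := (Classical.choose_spec (seriesLevel_exists (b (k + 1)) (b k) (v (k + 2)))).2.2.1 s hne hgood
    rw [← hb2] at h
    exact h
  · have h := (Classical.choose_spec (seriesLevel_exists (b (k + 1)) (b k) (v (k + 2)))).2.2.2 i s hne hgood
    rw [← hb2] at h
    exact h

/-! ## Uniqueness -/

/-- A non-null loop sequence with non-null components has positive total length. [folklore] -/
theorem len_pos_of_components_ne_nil {s : LoopSeq d} (hne : s ≠ []) (h : ∀ l ∈ s, l ≠ []) : 0 < s.len := by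
  obtain ⟨l, hl⟩ := List.exists_mem_of_ne_nil s hne
  have h1 : 1 ≤ l.length := List.length_pos_of_ne_nil (h l hl)
  have h2 : l.length ≤ s.len := by
    unfold LoopSeq.len
    exact List.le_sum_of_mem (List.mem_map.mpr ⟨l, hl, rfl⟩)
  omega

/-- **The coefficient family is unique**: the characterising clauses of `seriesCoeff_exists` determine `b` (induction on the
level, the `β`-degree and the index `ι(s)`). [cite: ChatterjeeJafarov2016OneOverN, §7 («suppose we have defined a_{i',k'}(s') for all triples … then let»); Chatterjee2019LargeN, Lemma 9.8] -/
theorem seriesCoeff_unique {b b' : ℕ → ℕ → LoopSeq d → ℝ}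
    (h0 : ∀ (i : ℕ) (u : LoopSeq d), b 0 i u = 0) (h1 : ∀ (i : ℕ) (u : LoopSeq d), b 1 i u = 0)
    (hnil : ∀ k i, b (k + 2) i [] = if k = 0 ∧ i = 0 then 1 else 0)
    (hbad : ∀ (j i : ℕ) (s : LoopSeq d), s ≠ [] → ¬ (∀ l ∈ s, l ≠ []) → b j i s = 0)
    (hrec0 : ∀ (k : ℕ) (s : LoopSeq d), s ≠ [] → (∀ l ∈ s, l ≠ []) →
      (s.len : ℝ) * b (k + 2) 0 s -
          ((∑ o : InvIdx s, b (k + 2) 0 (s.negSplitAt o)) - (∑ o : SameIdx s, b (k + 2) 0 (s.posSplitAt o))) =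
        (s.len : ℝ) * b (k + 1) 0 s
          + ((∑ o : SameIdx s, b (k + 1) 0 (s.negTwistAt o)) - ∑ o : InvIdx s, b (k + 1) 0 (s.posTwistAt o))
          + ((∑ o : MergeIdx s, b k 0 (s.negMergeAt o)) - ∑ o : MergeIdx s, b k 0 (s.posMergeAt o)))
    (hrecS : ∀ (k i : ℕ) (s : LoopSeq d), s ≠ [] → (∀ l ∈ s, l ≠ []) →
      (s.len : ℝ) * b (k + 2) (i + 1) s -
          ((∑ o : InvIdx s, b (k + 2) (i + 1) (s.negSplitAt o)) - (∑ o : SameIdx s, b (k + 2) (i + 1) (s.posSplitAt o))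
            + (∑ o : DeformIdx s, b (k + 2) i (s.negDeformAt o)) - (∑ o : DeformIdx s, b (k + 2) i (s.posDeformAt o))) =
        (s.len : ℝ) * b (k + 1) (i + 1) s
          + ((∑ o : SameIdx s, b (k + 1) (i + 1) (s.negTwistAt o)) - ∑ o : InvIdx s, b (k + 1) (i + 1) (s.posTwistAt o))
          + ((∑ o : MergeIdx s, b k (i + 1) (s.negMergeAt o)) - ∑ o : MergeIdx s, b k (i + 1) (s.posMergeAt o)))
    (h0' : ∀ (i : ℕ) (u : LoopSeq d), b' 0 i u = 0) (h1' : ∀ (i : ℕ) (u : LoopSeq d), b' 1 i u = 0)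
    (hnil' : ∀ k i, b' (k + 2) i [] = if k = 0 ∧ i = 0 then 1 else 0)
    (hbad' : ∀ (j i : ℕ) (s : LoopSeq d), s ≠ [] → ¬ (∀ l ∈ s, l ≠ []) → b' j i s = 0)
    (hrec0' : ∀ (k : ℕ) (s : LoopSeq d), s ≠ [] → (∀ l ∈ s, l ≠ []) →
      (s.len : ℝ) * b' (k + 2) 0 s -
          ((∑ o : InvIdx s, b' (k + 2) 0 (s.negSplitAt o)) - (∑ o : SameIdx s, b' (k + 2) 0 (s.posSplitAt o))) =
        (s.len : ℝ) * b' (k + 1) 0 s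
          + ((∑ o : SameIdx s, b' (k + 1) 0 (s.negTwistAt o)) - ∑ o : InvIdx s, b' (k + 1) 0 (s.posTwistAt o))
          + ((∑ o : MergeIdx s, b' k 0 (s.negMergeAt o)) - ∑ o : MergeIdx s, b' k 0 (s.posMergeAt o)))
    (hrecS' : ∀ (k i : ℕ) (s : LoopSeq d), s ≠ [] → (∀ l ∈ s, l ≠ []) →
      (s.len : ℝ) * b' (k + 2) (i + 1) s -
          ((∑ o : InvIdx s, b' (k + 2) (i + 1) (s.negSplitAt o)) - (∑ o : SameIdx s, b' (k + 2) (i + 1) (s.posSplitAt o))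
            + (∑ o : DeformIdx s, b' (k + 2) i (s.negDeformAt o)) - (∑ o : DeformIdx s, b' (k + 2) i (s.posDeformAt o))) =
        (s.len : ℝ) * b' (k + 1) (i + 1) s
          + ((∑ o : SameIdx s, b' (k + 1) (i + 1) (s.negTwistAt o)) - ∑ o : InvIdx s, b' (k + 1) (i + 1) (s.posTwistAt o))
          + ((∑ o : MergeIdx s, b' k (i + 1) (s.negMergeAt o)) - ∑ o : MergeIdx s, b' k (i + 1) (s.posMergeAt o))) :
    b = b' := by
  funext j
  induction j using Nat.strong_induction_on with
  | _ j ihj =>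
  rcases j with _ | _ | k
  · funext i u; rw [h0, h0']
  · funext i u; rw [h1, h1']
  have hk1 : b (k + 1) = b' (k + 1) := ihj _ (by omega)
  have hk0 : b k = b' k := ihj _ (by omega)
  -- one `β`-degree, given the previous one
  have step : ∀ (i : ℕ), (∀ s : LoopSeq d, s ≠ [] → (∀ l ∈ s, l ≠ []) →
      (s.len : ℝ) * b (k + 2) i s -
          ((∑ o : InvIdx s, b (k + 2) i (s.negSplitAt o)) - (∑ o : SameIdx s, b (k + 2) i (s.posSplitAt o))) =
      (s.len : ℝ) * b' (k + 2) i s -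
          ((∑ o : InvIdx s, b' (k + 2) i (s.negSplitAt o)) - (∑ o : SameIdx s, b' (k + 2) i (s.posSplitAt o)))) →
      b (k + 2) i = b' (k + 2) i := by
    intro i hE
    funext s
    suffices H : ∀ (n : ℕ) (s : LoopSeq d), s.index = n → b (k + 2) i s = b' (k + 2) i s from H _ s rfl
    intro n
    induction n using Nat.strong_induction_on with
    | _ n ihn =>
    intro s hsn
    by_cases hne : s = []
    · subst hne; rw [hnil, hnil']
    by_cases hgood : ∀ l ∈ s, l ≠ []
    · have hlen : (0 : ℝ) < s.len := by exact_mod_cast len_pos_of_components_ne_nil hne hgood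
      have e := hE s hne hgood
      have hS1 : (∑ o : InvIdx s, b (k + 2) i (s.negSplitAt o)) = ∑ o : InvIdx s, b' (k + 2) i (s.negSplitAt o) :=
        Finset.sum_congr rfl fun o _ => ihn _ (hsn ▸ LoopSeq.index_negSplitAt_lt hgood o) _ rfl
      have hS2 : (∑ o : SameIdx s, b (k + 2) i (s.posSplitAt o)) = ∑ o : SameIdx s, b' (k + 2) i (s.posSplitAt o) :=
        Finset.sum_congr rfl fun o _ => ihn _ (hsn ▸ LoopSeq.index_posSplitAt_lt hgood o) _ rfl
      rw [hS1, hS2] at e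
      have e' : (s.len : ℝ) * (b (k + 2) i s - b' (k + 2) i s) = 0 := by linarith
      rcases mul_eq_zero.mp e' with h | h
      · exact absurd h hlen.ne'
      · linarith
    · rw [hbad _ _ s hne hgood, hbad' _ _ s hne hgood]
  funext i
  induction i with
  | zero =>
    refine step 0 fun s hne hgood => ?_
    rw [hrec0 k s hne hgood, hrec0' k s hne hgood, hk1, hk0]
  | succ i ihi =>
    refine step (i + 1) fun s hne hgood => ?_
    have e := hrecS k i s hne hgood
    have e' := hrecS' k i s hne hgood
    rw [ihi, hk1, hk0] at e
    linarith

end StringDuality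

end Summit.QuantumFields.GaugeBoot

end
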